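import Summits.ResolutionOfSingularities.ResolutionOfSingularities.Theorems.SurfacePort
import Literature.AlgebraicGeometry.Resolution.HironakaTauScheme
import Literature.AlgebraicGeometry.Resolution.NearChainTermination
import Literature.AlgebraicGeometry.Resolution.NearPointTauMonotone
import Literature.AlgebraicGeometry.Resolution.NearPointsPointCentre
import Literature.AlgebraicGeometry.Resolution.AdaptedTauOneForms
import Literature.AlgebraicGeometry.Resolution.IsolatedOrderPoint
import Literature.AlgebraicGeometry.Resolution.Hironaka2005CompletionRegular
import Literature.AlgebraicGeometry.Resolution.RegularLocalRingsNormal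
import Literature.AlgebraicGeometry.Resolution.RegularSubschemeLocallyIrreducible
import Literature.AlgebraicGeometry.Resolution.BlowupSNC
import Summits.ResolutionOfSingularities.ResolutionOfSingularities.Theorems.MarkedTransferCampaignW46ThreefoldsTauTwoSlice
import Summits.ResolutionOfSingularities.ResolutionOfSingularities.Theorems.FrobeniusLadderFInjectiveMacaulayficationProp44Assembly
import Mathlib.Algebra.CharP.Lemmas
import HarnessLib

/-!
# TauChainLaw — decomp-res node «TauChainCut» (lens-4 g32 REV 2, critic row 186 CLEARED DECIDED +1 · MAP 0), tree
file 1/5 of the node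

Content VERBATIM from the decomp-res lens-4 g32 node REV 2 `HOME/decomp-res-lens-4/g32/TauChainCut_rev2.lean` (pin
d70c0cc0, 841 l, 78 decls; HOME = run/shared/lean/pub/decomp-res): the node imports the LANDED tree only
(`SurfacePortCells` + `MaxContactCutSurfacePort` of g31 and their chains) and CARRIES NOTHING — every declaration is
new, same namespace `…Theorems.HugValuationCut` (rev 2 = rev 1 minus the carried g31 block; the new part is
byte-identical to rev 1 l. 531–1324).  Farm (node, critic's own run): rc 0 · 0 err · 0 warn · 0 sorry · axioms std.
Critic: CRITIC-LEDGER row 186 CLEARED DECIDED +1 · MAP 0 (lane (Π-τ): the principal-root ring-dimension-3 column of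
the g31 residual is CLOSED — Law A `noTower_threefold_not_tauOne` + the g31 port; the steep-threefold,
principal-threefold non-surface and curve-like-threefold cells are decided in kernel; the located residual is the
MIXED class).  Landing orders = the lens's INBOX :984 / NEXT-g33.md §4 endorsed by the critic rider INBOX :996: (1)
`TauChainLaw` = §92–§94 + §96 (letters, Law A, Kernel B, Law C), (2) `TauChainCutCells` = §95 + §97 minus the four
`h71` corollaries + §98 (imports (1) + `SurfacePortCells`; cone-free: the aside home), (3)
`MaxContactCutTauChainCut` = the four `h71` corollaries GIVEN 31571 `MaxContactCut.NoContactHuggingTowers` BY NAME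
(Theses cone; imports `MaxContactCutSurfacePort` + (2)); all VERBATIM, `--kind proof --supports
stmt-ResolutionOfSingularities-28338`; the new `def … : Prop` (`TauOneTower`, `SteepThreefold`, `CurveLikeTower`,
the `*Terminate` cells, the `NoWild*` names) are cells / letters of THIS node, none is a vendored fact; `towerTau`
is ℕ-valued.  Aside bookkeeping (rider (4)): ONE aside SWITCH on the lens-4 column —
`NoWildMixedWallFreeFreshJumpShallowCompanionKangarooTowers` (home `TauChainCutCells`) SUPERSEDES the g31 aside
`NSNoWildNonSurfaceWallFreeFreshJumpShallowCompanionKangarooTowers` (item 28078).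

The lens header, verbatim:

> # TauChainCut — decomp-res-lens-4 g32 node «TauChainCut» (see the module docstrings of §92–§98 and
HOME/decomp-res-lens-4/g32/NODE-g32.md)

## This file

§92 (NEW) THE τ-LETTER — Hironaka's `τ` of the marked idealistic exponent at the marked points (`section TauLetter`:
`towerTau` (an ℕ-valued def), `TauOneTower`); §93 (NEW · KERNEL) LAW A — THE τ-CHAIN LAW
`noTower_threefold_not_tauOne` (`section TauChain`: in ring dimension 3, `τ ≡ 1` along EVERY forced tower — every
`p`, every field; near-point τ-monotonicity + near-chain termination by name); §94 (NEW · KERNEL) KERNEL B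
`planeConeAt_of_stalkTau_eq_one` (`section TauOneCone`: `τ = 1` in embedding dimension 3 IS a rational PLANE CONE,
every ideal, principal or not); §96 (NEW · KERNEL) LAW C — THE CURVE-LIKE LAW `noTower_threefold_curveLike`
(`section CurveLike`: `CurveLikeTower`; no forced tower in ring dimension 3 whose marked ideals are ideals of
regular curves) — continued in `TauChainLaw2`… where the 400-line cap cuts.  (This first part carries:
`TauOneTower`, `tower_isRegular`, `towerTau`, `tauOneTower_iff_towerTau`, `tower_isClosed_base`,
`tower_closeds_base_eq`, `tower_isBlowup_base`, `tower_ideal_succ_eq_controlledTransform_base`, `tower_isNear_base`,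
`tower_spanFinrank_eq_three`, `tower_spanFinrank_eq_three_base`, `tower_isGRing_stalk`,
`tower_not_le_idealOrder_of_specializes`, `tower_not_map_le_pow`, `tower_not_map_le_pow_base`, `towerTau_pos`,
`towerTau_le_two`, `towerTau_succ_eq_two`, `towerTau_add_eq_two`, `noTower_threefold_not_tauOne`,
`noTowerWild_threefold_not_tauOne`.)

[WRITER NOTE (decomp-res writer g12): file split only (tree files ≤ 400 lines); namespace, sections, section
variables / opens and every declaration exactly as in the lens (the node's global dupNamespace-linter line is
dropped — the library sets it; the `open …Theses` line lives only in the Theses-cone file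
`MaxContactCutTauChainCut`; the lens's cone imports `MaxContactCutSatelliteCut` / `MaxContactCutWallCutCells` /
`MaxContactCutSurfacePort` are confined to the cone file, the cone-free files import `SurfacePort` /
`SurfacePortCells` (⊇ the Wall / History / Depth cut cells they open) per rider (1)–(2)).]

(Sources: Hironaka1964 Ch. III (τ, directrix); Hironaka1970 / Giraud1975 (near points, τ-monotonicity);
CossartJannsenSaito2020 Thm. 6.40, Def. 6.38–6.39, Thm. 6.35 / Cor. 6.37, Ch. 8; Hauser2010Kangaroo;
HauserPerlega2019 §2; CossartPiltant2008 §2; CossartPiltant2019; Hironaka2005; Matsumura1987 §28; StacksProject 0804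
/ 0BIQ / 031I.)
-/

noncomputable section

open CategoryTheory AlgebraicGeometry IsLocalRing TopologicalSpace
open Literature.AlgebraicGeometry.Resolution
open Summit.ResolutionOfSingularities.ResolutionOfSingularities.Theorems
open WeakOrderReduction ForcedTowerClasses DivergentTowerClasses MonomialTowerClasses
open HugDimensionClasses HugDimensionKernels SurfaceShadowClasses SurfaceShadowKernels
open NearPointCut (SingularClass)
open Scheme.IdealSheafData (vanishingIdeal)
open scoped BigOperators

namespace Summit.ResolutionOfSingularities.ResolutionOfSingularities.Theorems.HugValuationCut

section TauLetter

variable {k : Type} [Field k]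

/-! ## ══ NO CARRY (rev 2).  g31 «SurfacePort» §87–§91 LANDED during this generation (writer-1 g11, STATUS 2026-08-31T05:35:31Z:
`Theorems/SurfacePort` p811860 · `Theorems/SurfacePortCells` p811924 · `Theorems/MaxContactCutSurfacePort` p812007,
declaration names identical to
g31's b367c4d1 l. 189–670) and is IMPORTED above; rev 1 of this node (sha256 ebc88a69…, STATUS PIN
2026-08-31T05:40:31Z) carried that block
byte-identically at its l. 46–530 — rev 2 deletes it and changes NOTHING else (the new part §92–§98 below is
byte-identical to rev 1 l. 531–1324).
Everything below is NEW in g32. ══ -/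

/-! ## §92 (g32 · NEW) THE τ-LETTER — Hironaka's `τ` of the marked idealistic exponent at the marked points

For a forced tower `T` over a base every stage is regular (`tower_isLocallyNoetherian_isRegular`), so Hironaka's invariant
`τ(x_i) := dim_{κ(x_i)} Dir(in_n 𝓘_{i,x_i})` (tree `stalkTau`, Cossart–Piltant 2008 §4) is defined at every marked point; the letter
`TauOneTower n T` says `τ(x_i) = 1` for all `i` (stated for every regularity witness — `IsRegularLocalRing` is a
proposition, so the
value does not depend on it).  In a regular local ring of dimension 3, `τ ∈ {1, 2, 3}` at a point of order exactly `n ≥ 1`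
(`one_le_stalkTau`, `stalkTau_le`); classically `e(x) = 3 − τ(x)` is the dimension of the directrix, and `PlaneConeAt`
(g31's letter, «`e = ē = 2` with a RATIONAL plane») is the case `τ = 1` read on one generator (§94 proves `τ = 1 ⇒ PlaneConeAt`
for every ideal, principal or not). -/

/-- **`TauOneTower n T` — HIRONAKA'S `τ` IS `1` AT EVERY MARKED POINT** (NEW TYPED PREDICATE, field-free): for every
stage `i` and
every regularity witness of the marked local ring `𝒪_{X_i,x_i}`, `τ(𝓘_{i,x_i}, n) = 1` — the directrix of the degree-`n` initial
ideal is cut out by ONE linear form (`e(x_i) = 2`: the tangent cone is an `n`-fold plane over `κ(x_i)`, Cossart–Jannsen–Saito's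
case `e_x = 2`, the habitat of the polygon `Δ(f; u₁, u₂; y)`). -/
def TauOneTower (n : ℕ) (T : ForcedTower) : Prop :=
  ∀ (i : ℕ) (h : IsRegularLocalRing ((T.St i).presheaf.stalk (T.pt i))), @stalkTau (T.St i) (T.D i).ideal (T.pt i) h n = 1

/-- the regularity witness of the stages of a forced tower over a base used throughout (`tower_isLocallyNoetherian_isRegular`).
[folklore] -/
theorem tower_isRegular (T : ForcedTower) (g : T.St 0 ⟶ Spec (.of k)) (hB : IsBase (T.St 0) g) (i : ℕ) :
    Scheme.IsRegular (T.St i) :=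
  (tower_isLocallyNoetherian_isRegular T g hB i).2

/-- **`towerTau T g hB n i = τ(x_i)`** — Hironaka's `τ` of `(𝓘_i, n)` at the marked point of stage `i`, computed
with the witness
`tower_isRegular`. -/
def towerTau (T : ForcedTower) (g : T.St 0 ⟶ Spec (.of k)) (hB : IsBase (T.St 0) g) (n i : ℕ) : ℕ :=
  @stalkTau (T.St i) (T.D i).ideal (T.pt i) (tower_isRegular T g hB i (T.pt i)) n

/-- the letter read on `towerTau`. [folklore] -/
theorem tauOneTower_iff_towerTau (T : ForcedTower) (g : T.St 0 ⟶ Spec (.of k)) (hB : IsBase (T.St 0) g) (n : ℕ) :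
    TauOneTower n T ↔ ∀ i, towerTau T g hB n i = 1 :=
  ⟨fun h i => h i _, fun h i _ => h i⟩

end TauLetter

section TauChain

variable {k : Type} [Field k]

/-! ## §93 (g32 · NEW · KERNEL) LAW A — THE τ-CHAIN LAW: in ring dimension 3, `τ ≡ 1` along EVERY forced tower (every `p`, every
field, every class, every weight `n ≥ 1`).

PROOF (all ingredients are PROVED tree theorems, scheme-level, no port).  At every stage `x_{i+1}` is NEAR `x_i`
(`ord = n` again) for
the blow-up of the reduced closed point `x_i` of the regular threefold germ, so `τ(x_i) ≤ 2` (Cossart–Piltant Lemma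
4.3 (1), tree
`IsBlowup.stalkTau_le_two_of_isNear_point`: a point with `τ = 3` has no near point) and `τ(x_i) ≥ 1`
(`one_le_stalkTau`).  If some
`τ(x_{i₀}) ≠ 1` then `τ(x_{i₀}) = 2`, and `τ = 2` PROPAGATES to every later stage (Lemma 4.3 (3), tree
`IsBlowup.stalkTau_le_stalkTau_of_isNear_point`: `2 = τ(x_i) ≤ τ(x_{i+1}) ≤ 2`).  The shifted tower `(X_{i₀+m},
x_{i₀+m})_m` is then
an infinite chain of `τ = 2` near points over the ISOLATED point `x_{i₀}` of `{ord ≥ n}` (tower axiom `isolated`,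
turned into the
prime-localisation statement by the tree's `not_map_le_pow_of_isolated`) of a local ring which is a G-RING (finite
type over a field:
`isGRing_stalk_of_locallyOfFiniteType` for the composite structure map `toRoot T i₀ ≫ g`), which the tree theorem
`false_of_nearChain_tau_two` (Cossart–Piltant Prop. 4.4, case `τ = 2`, p. 11: the formal curve `Γ = ∩ V(û₁⁽ⁿ⁾,
û₂⁽ⁿ⁾)` would lie in
`{ord ≥ n}`) forbids. -/

/-- the image `π_i(x_{i+1})` (`= x_i`) is a closed point. [folklore] -/
theorem tower_isClosed_base (T : ForcedTower) (i : ℕ) : IsClosed ({(T.π i).base (T.pt (i + 1))} : Set (T.St i)) := by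
  rw [T.pt_map]; exact T.isClosed_pt i

/-- the reduced closed point `{π_i(x_{i+1})}` is the reduced closed point `{x_i}` (as closed sets). [folklore] -/
theorem tower_closeds_base_eq (T : ForcedTower) (i : ℕ) (h : IsClosed ({(T.π i).base (T.pt (i + 1))} : Set (T.St i))) :
    (⟨{(T.π i).base (T.pt (i + 1))}, h⟩ : Closeds (T.St i)) = ⟨{T.pt i}, T.isClosed_pt i⟩ :=
  Closeds.ext (congrArg Singleton.singleton (T.pt_map i))

/-- the blow-up of stage `i` is the blowing up of the reduced closed point `π_i(x_{i+1})`. [folklore] -/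
theorem tower_isBlowup_base (T : ForcedTower) (i : ℕ) :
    IsBlowup (T.π i) (vanishingIdeal ⟨{(T.π i).base (T.pt (i + 1))}, tower_isClosed_base T i⟩) := by
  rw [tower_closeds_base_eq]; exact tower_isBlowup_vanishingIdeal T i

/-- the controlled-transform recursion, centred at `π_i(x_{i+1})`. [folklore] -/
theorem tower_ideal_succ_eq_controlledTransform_base (T : ForcedTower) {n : ℕ} (hD : IsDatum n (T.D 0)) (i : ℕ) :
    (T.D (i + 1)).ideal =
      controlledTransform (T.π i) (vanishingIdeal ⟨{(T.π i).base (T.pt (i + 1))}, tower_isClosed_base T i⟩) (T.D i).ideal n := by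
  rw [tower_closeds_base_eq]; exact tower_ideal_succ_eq_controlledTransform T hD i

/-- `x_{i+1}` is near `π_i(x_{i+1})`. [folklore] -/
theorem tower_isNear_base (T : ForcedTower) (g : T.St 0 ⟶ Spec (.of k)) (hB : IsBase (T.St 0) g) {n : ℕ}
    (hD : IsDatum n (T.D 0)) (i : ℕ) :
    IsNear (T.π i) (vanishingIdeal ⟨{(T.π i).base (T.pt (i + 1))}, tower_isClosed_base T i⟩) (T.D i).ideal n (T.pt (i + 1)) := by
  rw [tower_closeds_base_eq]; exact tower_isNear_pt T g hB hD i

/-- **embedding dimension 3 at every marked point of a threefold tower** (regular: `emb dim = dim = 3`). [folklore] -/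
theorem tower_spanFinrank_eq_three (T : ForcedTower) (g : T.St 0 ⟶ Spec (.of k)) (hB : IsBase (T.St 0) g)
    (h3 : ThreefoldTower T) (i : ℕ) : (maximalIdeal ((T.St i).presheaf.stalk (T.pt i))).spanFinrank = 3 := by
  haveI : IsRegularLocalRing ((T.St i).presheaf.stalk (T.pt i)) := tower_isRegular T g hB i (T.pt i)
  have h := IsRegularLocalRing.spanFinrank_maximalIdeal (R := (T.St i).presheaf.stalk (T.pt i))
  rw [ringKrullDim_eq_three_of_threefoldTower h3 i] at h
  exact_mod_cast h

/-- embedding dimension 3 at `π_i(x_{i+1})`. [folklore] -/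
theorem tower_spanFinrank_eq_three_base (T : ForcedTower) (g : T.St 0 ⟶ Spec (.of k)) (hB : IsBase (T.St 0) g)
    (h3 : ThreefoldTower T) (i : ℕ) :
    (maximalIdeal ((T.St i).presheaf.stalk ((T.π i).base (T.pt (i + 1))))).spanFinrank = 3 := by
  rw [T.pt_map]; exact tower_spanFinrank_eq_three T g hB h3 i

/-- **every local ring of every stage is a G-RING** (the stage is locally of finite type over the field: composite structure map
`toRoot T i ≫ g`, `tower_isBase`; Matsumura Cor. of Thm. 32.6, tree `isGRing_stalk_of_locallyOfFiniteType`). [folklore] -/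
theorem tower_isGRing_stalk (T : ForcedTower) (g : T.St 0 ⟶ Spec (.of k)) (hB : IsBase (T.St 0) g) (i : ℕ) (x : T.St i) :
    IsGRing ((T.St i).presheaf.stalk x) := by
  haveI : LocallyOfFiniteType (toRoot T i ≫ g) := (tower_isBase T g hB i).locallyOfFiniteType
  exact isGRing_stalk_of_locallyOfFiniteType (toRoot T i ≫ g) x

/-- **TOPOLOGICAL ISOLATION** of the marked point in `{ord ≥ n}` (tower axiom `isolated`): no proper generization of `x_i` has
order `≥ n`. [folklore] -/
theorem tower_not_le_idealOrder_of_specializes (T : ForcedTower) {n : ℕ} (hD : IsDatum n (T.D 0)) (i : ℕ) :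
    ∀ ζ : T.St i, ζ ⤳ T.pt i → ζ ≠ T.pt i → ¬ (((n : ℕ) : ℕ∞) ≤ idealOrder (T.D i).ideal ζ) := by
  intro ζ hζ hne hle
  obtain ⟨U, hxU, hU⟩ := tower_exists_isolating_open T hD i
  exact hne (hU ζ (hζ.mem_open U.isOpen hxU) hle)

/-- **PRIME-LOCALISATION ISOLATION (PROVED from topological isolation)**: for every non-maximal prime `𝔮 ⊂ 𝒪_{X_i,x_i}`,
`𝓘_{i,x_i}·𝒪_𝔮 ⊄ (𝔮𝒪_𝔮)^n` (tree `not_map_le_pow_of_isolated`). [folklore] -/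
theorem tower_not_map_le_pow (T : ForcedTower) {n : ℕ} (hD : IsDatum n (T.D 0)) (i : ℕ)
    (𝔮 : Ideal ((T.St i).presheaf.stalk (T.pt i))) [𝔮.IsPrime] (h𝔮 : 𝔮 ≠ maximalIdeal _) :
    ¬ (stalkIdeal (T.D i).ideal (T.pt i)).map (algebraMap _ (Localization.AtPrime 𝔮)) ≤
      maximalIdeal (Localization.AtPrime 𝔮) ^ n :=
  not_map_le_pow_of_isolated _ _ n (tower_not_le_idealOrder_of_specializes T hD i) 𝔮 h𝔮

/-- prime-localisation isolation at `π_i(x_{i+1})`. [folklore] -/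
theorem tower_not_map_le_pow_base (T : ForcedTower) {n : ℕ} (hD : IsDatum n (T.D 0)) (i : ℕ) :
    ∀ (𝔮 : Ideal ((T.St i).presheaf.stalk ((T.π i).base (T.pt (i + 1))))) [𝔮.IsPrime], 𝔮 ≠ maximalIdeal _ →
      ¬ (stalkIdeal (T.D i).ideal ((T.π i).base (T.pt (i + 1)))).map (algebraMap _ (Localization.AtPrime 𝔮)) ≤
        maximalIdeal (Localization.AtPrime 𝔮) ^ n := by
  have key : ∀ x : T.St i, x = T.pt i → ∀ (𝔮 : Ideal ((T.St i).presheaf.stalk x)) [𝔮.IsPrime], 𝔮 ≠ maximalIdeal _ →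
      ¬ (stalkIdeal (T.D i).ideal x).map (algebraMap _ (Localization.AtPrime 𝔮)) ≤
        maximalIdeal (Localization.AtPrime 𝔮) ^ n := by
    rintro x rfl 𝔮 _ h𝔮
    exact tower_not_map_le_pow T hD i 𝔮 h𝔮
  exact key _ (T.pt_map i)

/-- **`1 ≤ τ(x_i)`** (the marked order is exactly `n ≥ 1`). [folklore] -/
theorem towerTau_pos (T : ForcedTower) (g : T.St 0 ⟶ Spec (.of k)) (hB : IsBase (T.St 0) g) {n : ℕ} (hn : 1 ≤ n)
    (hD : IsDatum n (T.D 0)) (i : ℕ) : 1 ≤ towerTau T g hB n i := by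
  unfold towerTau
  haveI := tower_isRegular T g hB i (T.pt i)
  exact one_le_stalkTau _ _ hn (tower_idealOrder_pt_eq T g hB hD i)

/-- **`τ(x_i) ≤ 2` IN RING DIMENSION 3** — `x_{i+1}` is a near point over the point centre `x_i` (Cossart–Piltant Lemma 4.3 (1):
a `τ = 3` point has no near point). [folklore] -/
theorem towerTau_le_two (T : ForcedTower) (g : T.St 0 ⟶ Spec (.of k)) (hB : IsBase (T.St 0) g) {n : ℕ}
    (hD : IsDatum n (T.D 0)) (h3 : ThreefoldTower T) (i : ℕ) : towerTau T g hB n i ≤ 2 := by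
  have hNR := tower_isLocallyNoetherian_isRegular T g hB
  haveI : IsLocallyNoetherian (T.St i) := (hNR i).1
  haveI : IsLocallyNoetherian (T.St (i + 1)) := (hNR (i + 1)).1
  have key : (haveI := tower_isRegular T g hB i ((T.π i).base (T.pt (i + 1)));
      stalkTau (T.D i).ideal ((T.π i).base (T.pt (i + 1))) n) ≤ 2 := by
    haveI := tower_isRegular T g hB i ((T.π i).base (T.pt (i + 1)))
    have hd := tower_spanFinrank_eq_three_base T g hB h3 i
    obtain ⟨c, hc, hcY⟩ := CampaignW46.exists_rsop_three (tower_isClosed_base T i) hd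
    exact (tower_isBlowup_base T i).stalkTau_le_two_of_isNear_point hd hc hcY (tower_isNear_base T g hB hD i)
  unfold towerTau
  rw [CampaignW46.stalkTau_congr (tower_isRegular T g hB i) (T.D i).ideal n (T.pt_map i).symm]
  exact key

/-- **`τ = 2` PROPAGATES** (Cossart–Piltant Lemma 4.3 (3): `τ(x_{i+1}) ≥ τ(x_i) = 2` at the near point, and `τ(x_{i+1}) ≤ 2`).
[folklore] -/
theorem towerTau_succ_eq_two (T : ForcedTower) (g : T.St 0 ⟶ Spec (.of k)) (hB : IsBase (T.St 0) g) {n : ℕ} (hn : 1 ≤ n)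
    (hD : IsDatum n (T.D 0)) (h3 : ThreefoldTower T) (i : ℕ) (hτ : towerTau T g hB n i = 2) :
    towerTau T g hB n (i + 1) = 2 := by
  have hNR := tower_isLocallyNoetherian_isRegular T g hB
  haveI : IsLocallyNoetherian (T.St i) := (hNR i).1
  haveI : IsLocallyNoetherian (T.St (i + 1)) := (hNR (i + 1)).1
  have h2 := towerTau_le_two T g hB hD h3 (i + 1)
  unfold towerTau at hτ h2 ⊢
  rw [CampaignW46.stalkTau_congr (tower_isRegular T g hB i) (T.D i).ideal n (T.pt_map i).symm] at hτ
  have key : (haveI := tower_isRegular T g hB i ((T.π i).base (T.pt (i + 1)));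
      stalkTau (T.D i).ideal ((T.π i).base (T.pt (i + 1))) n) ≤
      (haveI := tower_isRegular T g hB (i + 1) (T.pt (i + 1)); stalkTau (T.D (i + 1)).ideal (T.pt (i + 1)) n) := by
    haveI := tower_isRegular T g hB i ((T.π i).base (T.pt (i + 1)))
    haveI := tower_isRegular T g hB (i + 1) (T.pt (i + 1))
    have hd := tower_spanFinrank_eq_three_base T g hB h3 i
    obtain ⟨c, hc, hcY⟩ := CampaignW46.exists_rsop_three (tower_isClosed_base T i) hd
    have hle := (tower_isBlowup_base T i).stalkTau_le_stalkTau_of_isNear_point hn hd hc hcY hτ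
      (tower_isNear_base T g hB hD i)
    rw [← tower_ideal_succ_eq_controlledTransform_base T hD i] at hle
    exact hle
  omega

/-- **once `τ = 2`, always `τ = 2`.** [folklore] -/
theorem towerTau_add_eq_two (T : ForcedTower) (g : T.St 0 ⟶ Spec (.of k)) (hB : IsBase (T.St 0) g) {n : ℕ} (hn : 1 ≤ n)
    (hD : IsDatum n (T.D 0)) (h3 : ThreefoldTower T) {i₀ : ℕ} (h0 : towerTau T g hB n i₀ = 2) :
    ∀ m, towerTau T g hB n (i₀ + m) = 2
  | 0 => h0
  | m + 1 => towerTau_succ_eq_two T g hB hn hD h3 (i₀ + m) (towerTau_add_eq_two T g hB hn hD h3 h0 m)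

/-- **LAW A — THE τ-CHAIN LAW (KERNEL, PROVED; every `p`, every field, every class `P`, every weight `n ≥ 1`): NO
forced tower of
ring dimension 3 has a marked point with `τ ≠ 1`.**  (Sources: CossartPiltant2008, Lemma 4.3 (1), (3), Prop. 4.4 (proof p. 11);
Matsumura1987, Cor. of Thm. 32.6; tree `false_of_nearChain_tau_two`.) -/
theorem noTower_threefold_not_tauOne {n : ℕ} (hn : 1 ≤ n) (P : ForcedTower → Prop) :
    NoTower n fun T => P T ∧ ThreefoldTower T ∧ ¬ TauOneTower n T := by
  intro p hp K _ _ T g hB hD hE hT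
  obtain ⟨-, h3, hτ1⟩ := hT
  have hNR := tower_isLocallyNoetherian_isRegular T g hB
  haveI : ∀ i, IsLocallyNoetherian (T.St i) := fun i => (hNR i).1
  -- a stage with `τ ≠ 1`, hence with `τ = 2`
  obtain ⟨i₀, hi₀⟩ : ∃ i, towerTau T g hB n i ≠ 1 := by
    by_contra hall
    push Not at hall
    exact hτ1 ((tauOneTower_iff_towerTau T g hB n).mpr hall)
  have h0 : towerTau T g hB n i₀ = 2 := by
    have h1 := towerTau_pos T g hB hn hD i₀
    have h2 := towerTau_le_two T g hB hD h3 i₀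
    omega
  have hτ2 := towerTau_add_eq_two T g hB hn hD h3 h0
  -- the shifted tower is an infinite chain of `τ = 2` near points over the isolated G-ring point `x_{i₀}`
  exact false_of_nearChain_tau_two (fun m => T.St (i₀ + m)) (fun m => T.π (i₀ + m)) (fun m => T.pt (i₀ + m + 1))
    (fun m => (T.D (i₀ + m)).ideal) hn (fun m => T.pt_map (i₀ + m + 1)) (fun m => tower_isClosed_base T (i₀ + m))
    (fun m => tower_isBlowup_base T (i₀ + m))
    (fun m => tower_isRegular T g hB (i₀ + m) _) (fun m => tower_isRegular T g hB (i₀ + m + 1) _)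
    (fun m => tower_spanFinrank_eq_three_base T g hB h3 (i₀ + m))
    (fun m => tower_ideal_succ_eq_controlledTransform_base T hD (i₀ + m))
    (fun m => tower_isNear_base T g hB hD (i₀ + m))
    (fun m => by
      have h := hτ2 m
      unfold towerTau at h
      rwa [CampaignW46.stalkTau_congr (tower_isRegular T g hB (i₀ + m)) (T.D (i₀ + m)).ideal n
        (T.pt_map (i₀ + m)).symm] at h)
    (fun m => hτ2 (m + 1))
    (stalkIdeal_le_pow_of_eq _ (T.pt_map i₀) (tower_stalkIdeal_le_pow T hD i₀))
    (tower_isGRing_stalk T g hB i₀ _)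
    (tower_not_map_le_pow_base T hD i₀)

/-- **LAW A on the wild column** (`p ∣ n`, `n ≥ 1`). [folklore] -/
theorem noTowerWild_threefold_not_tauOne {n : ℕ} (hn : 1 ≤ n) (P : ForcedTower → Prop) :
    NoTowerWild n fun T => P T ∧ ThreefoldTower T ∧ ¬ TauOneTower n T := by
  intro p hp hpn K _ _ T g hB hD hE hT
  exact noTower_threefold_not_tauOne hn P p hp K T g hB hD hE hT

end TauChain

end Summit.ResolutionOfSingularities.ResolutionOfSingularities.Theorems.HugValuationCut
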